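import Summits.QuantumFields.YangMills.Theorems.UnitScaleTiltProp7RSEqPrintProjectorOfLift
import Summits.QuantumFields.YangMills.Theorems.UnitScaleTiltProp7TopMeanDeltaPreimage
import Summits.QuantumFields.YangMills.Theorems.UnitScaleTiltProp7SectET3GaugeProjectorT3Rows
import HarnessLib

/-!
# Route `UnitScaleTilt`, crux K1 «MinimiserStabilityRegPr» (stmt-QuantumFields-19200), EX positivity block ∕ LIFT-THREAD 2 — **THE CONVERSE: `R_S(U₀) = projR (Δ^η_{U₀}) Q″ ⟹ Lift(U₀)`,
# HENCE `Lift(U₀) ⟺ R_S(U₀) = PRINT'S (3.21) PROJECTOR`** — the Lift antecedent of record is EXACTLY the locus where the intrinsic gauge projector of record equals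
# [Balaban1985BackgroundPropagators] p.394's «orthogonal projection onto `Δ^η_U N(Q′)`, `N(Q′) = ker Q′`» (`Q′ := Q″`, the top nested covariant mean of the averaging of record)

Cell `ym3-torus` (HUMAN RULING D-0037; rung R3 — NOT d = 4, NOT infinite volume, NOT a mass gap, NOT Clay).  Width seat `ym3-torus-px13` (gen 9).  THEOREMS ONLY (0 `def`, 0 `sorry`);
`--supports stmt-QuantumFields-19200 --as helper`; count-neutral.  Nothing of [B9] §3, N06, `hThm2S`, EX or the crux is asserted.

THE PROOF.  Let `cf` be a `Ū₀`-parallel coarse section.  By ✓`Prop7TopMeanDeltaPreimage.exists_preimage_topMean` there is `λ` with `Q″(toL2S λ) = cf`; its averaging sequence has a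
PARALLEL top, so `toL2S λ ∈ N_S(U₀)` (✓p734255 `mem_NS_of_topMean_parallel`) and `R_S` fixes `Δλ̃` (✓`RS_apply_covLapSite_of_mem`).  If `R_S = projR Δ Q″`, then `Δλ̃ = Δκ` with `Q″κ = 0`
(lit `exists_ker_projR_eq`), so `Δ(λ̃ − κ) = 0`, hence `D_{U₀}(λ̃ − κ) = 0` (`⟪μ, Δμ⟫ = ‖Dμ‖²`, ✓`inner_covLapSite`): `λ₀ := toL2S⁻¹(λ̃ − κ)` is `U₀♭`-PARALLEL (★px20 `toL2_symm_DL2_toL2S_eq`),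
its averaging sequence is `j ↦ λ₀ ∘ embIter j` (★px20 `hsucc_of_parallel`), so `λ₀ ∘ embIter (K−n) = Q″(toL2S λ₀) = cf − Q″κ = cf` — the lift.

WHAT IS PROVED (ns `…Theorems.Prop7LiftOfRSEqPrintProjector`; member `F`, `h : n ≤ K`, `c₀ > 0`, `cB`, `U₀ ∈ RegPr F n K ε₀`, `10¹²L³ε₀ ≤ 1`; `Q″` any linear map with ✓p734803's (iii) `htop`
[and (v) `hker` for ⟸]):
* `parallel_of_DL2_toL2S_eq_zero` (`D_{U₀}(toL2S λ₀) = 0 ⟹ λ₀` parallel), `DL2_eq_zero_of_covLapSite_eq_zero` (`Δμ = 0 ⟹ Dμ = 0`);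
* ★★★ `lift_of_RS_eq_projR` — `R_S U₀ = projR (covLapSite U₀) Q″ ⟹ Lift(U₀)` (the `hLift` text of ★px20 ✓`hHZ_of_parallelLift` ∕ the `Lift L i U₀` antecedent of record, VERBATIM);
* ★★★ `RS_eq_projR_iff_lift` — `R_S U₀ = projR (covLapSite U₀) Q″ ↔ Lift(U₀)` (⟸ = ✓p735568 `RS_eq_projR_of_lift`);
* ★★ `exists_intertwiner_RS_eq_projR_iff_lift` — packaged with ✓p734803's `(Q″, D′)`.
HONEST SCOPE.  Linear algebra over landed letters; no estimate; `Lift` is neither assumed nor discharged here (it is characterised).  Rung R3, not Clay; YM gap NOT proved.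

References: T. Bałaban, CMP **99** (1985) 389–434 [Balaban1985BackgroundPropagators] ((3.3) p.391, (3.19)–(3.23) pp.393–394, (3.114)–(3.115) p.418); CMP **98** (1985) 17–51
[Balaban1985Averaging] ((97) p.32).
-/

set_option autoImplicit false

noncomputable section

open scoped BigOperators Matrix.Norms.L2Operator InnerProductSpace

namespace Summit.QuantumFields.YangMills.Theorems.Prop7LiftOfRSEqPrintProjector

open NormedSpace
open Literature.MathematicalPhysics.QuantumFieldTheory.Balaban1983to89
open Literature.MathematicalPhysics.QuantumFieldTheory.Balaban1983to89.T3ContinuumYM3Torus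
open T4Continuum BlockAveraging
open BlockAveraging (Idx)
open B7Prop1Explicit (disp)
open B7Eq78Linearization (conjR conjR_apply)
open B10Eq27TorusAxialLog (holT transl)
open B7TransferAnalyticMean (meanCLM)
open B9Eq311L2Pairing (WL2)
open B11Eq103H1Complex (SiteL2K projR exists_ker_projR_eq)
open B15DeterminingSets (embIter)
open Summit.QuantumFields.YangMills.Theorems.Prop8Chart (emlIterU)
open T3PrintedRegularMinimiser (RegPr)
open T3PrintedRegularOrbits (sites_eq)
open T3LevelShift (bondShift)
open T3SectALandauChart (bgUnits eta eta_pos)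
open Summit.QuantumFields.YangMills.Theorems.Prop7SectET3Transport (periodsT3)
open Summit.QuantumFields.YangMills.Theorems.Prop7SectET3HilbertLetters (W₂ toL2 toL2S toL2B QL2 DL2 DstarL2 covLapSite inner_covLapSite)
open Summit.QuantumFields.YangMills.Theorems.Prop7SectET3GaugeProjector (QDS NS RS mem_NS_iff RS_eq_projR RS_apply_covLapSite_of_mem)
open Summit.QuantumFields.YangMills.Theorems.Prop7NestedMeanParallelLift (toL2_symm_DL2_toL2S_eq hsucc_of_parallel)
open Summit.QuantumFields.YangMills.Theorems.Prop7NSOfParallelTopMean (mem_NS_of_topMean_parallel)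
open Summit.QuantumFields.YangMills.Theorems.Prop7NSIntertwinerOfRecord (exists_linear_avgSeq exists_intertwiner_of_regPr)
open Summit.QuantumFields.YangMills.Theorems.Prop7RSEqPrintProjectorOfLift (RS_eq_projR_of_lift)
open Summit.QuantumFields.YangMills.Theorems.Prop7TopMeanDeltaPreimage (exists_preimage_topMean)

variable (F : T3Family) {n K : ℕ}

/-- **`D_{U₀}(toL2S λ₀) = 0` ⟹ `λ₀` IS `U₀♭`-PARALLEL** (the (3.3) stencil `η⁻¹•(Ad_{U₀♭(b)}λ₀(b₊) − λ₀(b₋))`, ★px20 `toL2_symm_DL2_toL2S_eq`, `η ≠ 0`).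
[cite: Balaban1985BackgroundPropagators, (3.3) p.391] -/
theorem parallel_of_DL2_toL2S_eq_zero {c₀ : ℝ} [Fact (0 < c₀)] (U₀ : GaugeField (F.P K) 0 (Matrix.specialUnitaryGroup (Fin 2) ℂ))
    (l₀ : Site (F.P K) 0 → Matrix (Fin 2) (Fin 2) ℂ) (hD : DL2 F n K c₀ U₀ (toL2S F K c₀ l₀) = 0) (b : PBond (F.P K) 0) :
    l₀ b.src = ((bgUnits F K U₀ b : (Matrix (Fin 2) (Fin 2) ℂ)ˣ) : Matrix (Fin 2) (Fin 2) ℂ) * l₀ b.tgt * (((bgUnits F K U₀ b)⁻¹ : (Matrix (Fin 2) (Fin 2) ℂ)ˣ) : Matrix (Fin 2) (Fin 2) ℂ) := by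
  have h := toL2_symm_DL2_toL2S_eq F (n := n) (c₀ := c₀) U₀ l₀
  rw [hD, map_zero] at h
  have hb := congrFun h b
  rw [Pi.zero_apply] at hb
  have hη : (((eta F n K : ℝ) : ℂ)⁻¹) ≠ 0 := inv_ne_zero (by exact_mod_cast (eta_pos F n K).ne')
  have h0 : conjR (bgUnits F K U₀ b) (l₀ b.tgt) - l₀ b.src = 0 := (smul_eq_zero.1 hb.symm).resolve_left hη
  rw [conjR_apply] at h0
  exact (sub_eq_zero.1 h0).symm

/-- **`Δ^η_{U₀}μ = 0` ⟹ `D_{U₀}μ = 0`** (`⟪μ, Δμ⟫ = ‖Dμ‖²`, ✓`inner_covLapSite`). [cite: Balaban1985BackgroundPropagators, (3.23) p.394] -/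
theorem DL2_eq_zero_of_covLapSite_eq_zero {c₀ : ℝ} [Fact (0 < c₀)] (U₀ : GaugeField (F.P K) 0 (Matrix.specialUnitaryGroup (Fin 2) ℂ))
    (μ : SiteL2K ℂ 3 (periodsT3 F K) c₀ W₂) (hΔ : covLapSite F n K c₀ U₀ μ = 0) : DL2 F n K c₀ U₀ μ = 0 := by
  have h := inner_covLapSite (n := n) U₀ μ
  rw [hΔ, inner_zero_right] at h
  have h2 : (‖DL2 F n K c₀ U₀ μ‖ : ℝ) ^ 2 = 0 := by exact_mod_cast h.symm
  exact norm_eq_zero.1 ((pow_eq_zero_iff two_ne_zero).1 h2)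

/-- ★★★ **`R_S(U₀) = projR (Δ^η_{U₀}) Q″` ⟹ `Lift(U₀)`** — if the intrinsic gauge projector of record coincides with print's (3.21) projector built on `N(Q′) = ker Q″` (for a linear `Q″` with the
top-mean property (iii) of ✓`Prop7NSIntertwinerOfRecord.exists_intertwiner_of_regPr`), then every `Ū₀`-parallel coarse section lifts to a `U₀♭`-parallel fine section (the `hLift` text of
★px20 ✓`hHZ_of_parallelLift`, VERBATIM). [cite: Balaban1985BackgroundPropagators, (3.19)-(3.23) pp.393-394, (3.115) p.418; Balaban1985Averaging, (97) p.32] -/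
theorem lift_of_RS_eq_projR (h : n ≤ K) {c₀ : ℝ} [Fact (0 < c₀)] (cB : ℝ) {ε₀ : ℝ} (hε₀ : 0 < ε₀) (hWε : 10 ^ 12 * (F.L : ℝ) ^ 3 * ε₀ ≤ 1)
    (U₀ : GaugeField (F.P K) 0 (Matrix.specialUnitaryGroup (Fin 2) ℂ)) (hreg : RegPr F n K ε₀ U₀)
    (Q'' : SiteL2K ℂ 3 (periodsT3 F K) c₀ W₂ →ₗ[ℂ] (Site (F.P K) (K - n) → Matrix (Fin 2) (Fin 2) ℂ))
    (htop : ∀ (lam : Site (F.P K) 0 → Matrix (Fin 2) (Fin 2) ℂ) (ns : (j : ℕ) → Site (F.P K) j → Matrix (Fin 2) (Fin 2) ℂ), ns 0 = lam →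
      (∀ (j : ℕ) (y : Site (F.P K) (j + 1)), ns (j + 1) y = ns j (emb y) - meanCLM (Idx (F.P K)) (Matrix (Fin 2) (Fin 2) ℂ) fun i : Idx (F.P K) =>
        ns j (emb y) - ((holT (emlIterU j (bgUnits F K U₀)) (emb y) (stairWord i.2.1 (off i.1)) : (Matrix (Fin 2) (Fin 2) ℂ)ˣ) : Matrix (Fin 2) (Fin 2) ℂ) *
          ns j (transl (emb y) (disp (stairWord i.2.1 (off i.1)))) * (((holT (emlIterU j (bgUnits F K U₀)) (emb y) (stairWord i.2.1 (off i.1)))⁻¹ : (Matrix (Fin 2) (Fin 2) ℂ)ˣ) : Matrix (Fin 2) (Fin 2) ℂ)) →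
      ns (K - n) = Q'' (toL2S F K c₀ lam))
    (hRS : RS F n K h c₀ cB U₀ = projR (covLapSite F n K c₀ U₀) Q'') :
    ∀ cf : Site (F.P K) (K - n) → Matrix (Fin 2) (Fin 2) ℂ,
      (∀ e : PBond (F.P K) (K - n), cf e.src = ((emlIterU (K - n) (bgUnits F K U₀) e : (Matrix (Fin 2) (Fin 2) ℂ)ˣ) : Matrix (Fin 2) (Fin 2) ℂ) * cf e.tgt *
        (((emlIterU (K - n) (bgUnits F K U₀) e)⁻¹ : (Matrix (Fin 2) (Fin 2) ℂ)ˣ) : Matrix (Fin 2) (Fin 2) ℂ)) →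
      ∃ l₀ : Site (F.P K) 0 → Matrix (Fin 2) (Fin 2) ℂ,
        (∀ b : PBond (F.P K) 0, l₀ b.src = ((bgUnits F K U₀ b : (Matrix (Fin 2) (Fin 2) ℂ)ˣ) : Matrix (Fin 2) (Fin 2) ℂ) * l₀ b.tgt * (((bgUnits F K U₀ b)⁻¹ : (Matrix (Fin 2) (Fin 2) ℂ)ˣ) : Matrix (Fin 2) (Fin 2) ℂ)) ∧
        ∀ y : Site (F.P K) (K - n), l₀ (embIter (K - n) y) = cf y := by
  intro cf hcf
  -- a preimage of `cf` under the top mean, and its averaging sequence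
  obtain ⟨lam, hlam⟩ := exists_preimage_topMean F h U₀ Q'' htop cf
  set T : (j : ℕ) → Site (F.P K) (j + 1) → Idx (F.P K) → (Matrix (Fin 2) (Fin 2) ℂ)ˣ :=
    fun j y i => holT (emlIterU j (bgUnits F K U₀)) (emb y) (stairWord i.2.1 (off i.1)) with hTdef
  obtain ⟨N, hN0, hNsucc⟩ := exists_linear_avgSeq (P := F.P K) (𝔸 := Matrix (Fin 2) (Fin 2) ℂ) T
  have htopN : N (K - n) lam = cf := by
    have h1 := htop lam (fun j => N j lam) (hN0 lam) (fun j y => hNsucc j lam y)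
    exact h1.trans hlam
  -- `toL2S λ ∈ N_S`: the top of its averaging sequence is parallel
  have hmem : toL2S F K c₀ lam ∈ NS F n K h c₀ cB U₀ :=
    mem_NS_of_topMean_parallel F h cB hε₀ hWε U₀ hreg (fun j => N j lam) lam (hN0 lam) (fun j y => hNsucc j lam y) fun e => by
      show conjR (emlIterU (K - n) (bgUnits F K U₀) e) (N (K - n) lam e.tgt) = N (K - n) lam e.src
      rw [htopN, conjR_apply]
      exact (hcf e).symm
  -- `Δλ̃ = Δκ` with `Q″κ = 0`
  have hfix : RS F n K h c₀ cB U₀ (covLapSite F n K c₀ U₀ (toL2S F K c₀ lam)) = covLapSite F n K c₀ U₀ (toL2S F K c₀ lam) :=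
    RS_apply_covLapSite_of_mem U₀ hmem
  rw [hRS] at hfix
  obtain ⟨κ, hκ0, hκ⟩ := exists_ker_projR_eq (covLapSite F n K c₀ U₀) Q'' (covLapSite F n K c₀ U₀ (toL2S F K c₀ lam))
  have hΔ : covLapSite F n K c₀ U₀ (toL2S F K c₀ lam - κ) = 0 := by
    rw [map_sub, ← hfix, hκ, sub_self]
  have hD : DL2 F n K c₀ U₀ (toL2S F K c₀ lam - κ) = 0 := DL2_eq_zero_of_covLapSite_eq_zero F (n := n) U₀ _ hΔ
  -- the parallel section `λ₀ := toL2S⁻¹ (λ̃ − κ)`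
  set l₀ : Site (F.P K) 0 → Matrix (Fin 2) (Fin 2) ℂ := (toL2S F K c₀).symm (toL2S F K c₀ lam - κ) with hl₀
  have hl₀' : toL2S F K c₀ l₀ = toL2S F K c₀ lam - κ := by rw [hl₀, LinearEquiv.apply_symm_apply]
  have hD₀ : DL2 F n K c₀ U₀ (toL2S F K c₀ l₀) = 0 := by rw [hl₀']; exact hD
  have hpar : ∀ b : PBond (F.P K) 0, l₀ b.src = ((bgUnits F K U₀ b : (Matrix (Fin 2) (Fin 2) ℂ)ˣ) : Matrix (Fin 2) (Fin 2) ℂ) * l₀ b.tgt *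
      (((bgUnits F K U₀ b)⁻¹ : (Matrix (Fin 2) (Fin 2) ℂ)ˣ) : Matrix (Fin 2) (Fin 2) ℂ) := parallel_of_DL2_toL2S_eq_zero F (n := n) U₀ l₀ hD₀
  have hpar' : ∀ b : PBond (F.P K) 0, conjR (bgUnits F K U₀ b) (l₀ b.tgt) = l₀ b.src := fun b => by rw [conjR_apply]; exact (hpar b).symm
  refine ⟨l₀, hpar, fun y => ?_⟩
  -- the averaging sequence of a parallel section is `j ↦ λ₀ ∘ embIter j`, so its top is `λ₀ ∘ embIter (K−n) = Q″(toL2S λ₀) = cf`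
  have htop₀ := htop l₀ (fun j z => l₀ (embIter j z)) rfl (fun j y' => hsucc_of_parallel (bgUnits F K U₀) l₀ hpar' j y')
  have hQ₀ : Q'' (toL2S F K c₀ l₀) = cf := by
    rw [hl₀', map_sub, hκ0, sub_zero, ← hlam]
  have hy := congrFun (htop₀.trans hQ₀) y
  exact hy

/-- ★★★ **`R_S(U₀) = projR (Δ^η_{U₀}) Q″ ⟺ Lift(U₀)`** — for any linear `Q″` with the top-mean property (iii) and `ker Q″ ≤ N_S(U₀)` (v) of ✓p734803: the intrinsic projector of record equals
print's (3.21) projector EXACTLY on the Lift locus (⟸ is ✓p735568 `RS_eq_projR_of_lift`). [cite: Balaban1985BackgroundPropagators, (3.20)-(3.23) p.394, (3.115) p.418] -/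
theorem RS_eq_projR_iff_lift (h : n ≤ K) {c₀ : ℝ} [Fact (0 < c₀)] (cB : ℝ) {ε₀ : ℝ} (hε₀ : 0 < ε₀) (hWε : 10 ^ 12 * (F.L : ℝ) ^ 3 * ε₀ ≤ 1)
    (U₀ : GaugeField (F.P K) 0 (Matrix.specialUnitaryGroup (Fin 2) ℂ)) (hreg : RegPr F n K ε₀ U₀)
    (Q'' : SiteL2K ℂ 3 (periodsT3 F K) c₀ W₂ →ₗ[ℂ] (Site (F.P K) (K - n) → Matrix (Fin 2) (Fin 2) ℂ))
    (htop : ∀ (lam : Site (F.P K) 0 → Matrix (Fin 2) (Fin 2) ℂ) (ns : (j : ℕ) → Site (F.P K) j → Matrix (Fin 2) (Fin 2) ℂ), ns 0 = lam →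
      (∀ (j : ℕ) (y : Site (F.P K) (j + 1)), ns (j + 1) y = ns j (emb y) - meanCLM (Idx (F.P K)) (Matrix (Fin 2) (Fin 2) ℂ) fun i : Idx (F.P K) =>
        ns j (emb y) - ((holT (emlIterU j (bgUnits F K U₀)) (emb y) (stairWord i.2.1 (off i.1)) : (Matrix (Fin 2) (Fin 2) ℂ)ˣ) : Matrix (Fin 2) (Fin 2) ℂ) *
          ns j (transl (emb y) (disp (stairWord i.2.1 (off i.1)))) * (((holT (emlIterU j (bgUnits F K U₀)) (emb y) (stairWord i.2.1 (off i.1)))⁻¹ : (Matrix (Fin 2) (Fin 2) ℂ)ˣ) : Matrix (Fin 2) (Fin 2) ℂ)) →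
      ns (K - n) = Q'' (toL2S F K c₀ lam))
    (hker : LinearMap.ker Q'' ≤ NS F n K h c₀ cB U₀) :
    RS F n K h c₀ cB U₀ = projR (covLapSite F n K c₀ U₀) Q'' ↔
      ∀ cf : Site (F.P K) (K - n) → Matrix (Fin 2) (Fin 2) ℂ,
        (∀ e : PBond (F.P K) (K - n), cf e.src = ((emlIterU (K - n) (bgUnits F K U₀) e : (Matrix (Fin 2) (Fin 2) ℂ)ˣ) : Matrix (Fin 2) (Fin 2) ℂ) * cf e.tgt *
          (((emlIterU (K - n) (bgUnits F K U₀) e)⁻¹ : (Matrix (Fin 2) (Fin 2) ℂ)ˣ) : Matrix (Fin 2) (Fin 2) ℂ)) →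
        ∃ l₀ : Site (F.P K) 0 → Matrix (Fin 2) (Fin 2) ℂ,
          (∀ b : PBond (F.P K) 0, l₀ b.src = ((bgUnits F K U₀ b : (Matrix (Fin 2) (Fin 2) ℂ)ˣ) : Matrix (Fin 2) (Fin 2) ℂ) * l₀ b.tgt * (((bgUnits F K U₀ b)⁻¹ : (Matrix (Fin 2) (Fin 2) ℂ)ˣ) : Matrix (Fin 2) (Fin 2) ℂ)) ∧
          ∀ y : Site (F.P K) (K - n), l₀ (embIter (K - n) y) = cf y :=
  ⟨lift_of_RS_eq_projR F h cB hε₀ hWε U₀ hreg Q'' htop,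
    fun hLift => RS_eq_projR_of_lift F h cB hε₀ hWε U₀ hreg hLift Q'' htop hker⟩

/-- ★★ **PACKAGED WITH THE INTERTWINER OF RECORD**: at `U₀ ∈ 𝔘_k(ε₀)` there are `Q″ D′` linear with `QL2 U₀ (DL2 U₀ l) = D′ (Q″ l)` ((3.114)–(3.115)) and
`R_S U₀ = projR (covLapSite U₀) Q″ ↔ Lift(U₀)`. [cite: Balaban1985BackgroundPropagators, (3.114)-(3.115) p.418, (3.20)-(3.23) p.394] -/
theorem exists_intertwiner_RS_eq_projR_iff_lift (h : n ≤ K) {c₀ : ℝ} [Fact (0 < c₀)] (cB : ℝ) {ε₀ : ℝ} (hε₀ : 0 < ε₀) (hWε : 10 ^ 12 * (F.L : ℝ) ^ 3 * ε₀ ≤ 1)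
    (U₀ : GaugeField (F.P K) 0 (Matrix.specialUnitaryGroup (Fin 2) ℂ)) (hreg : RegPr F n K ε₀ U₀) :
    ∃ (Q'' : SiteL2K ℂ 3 (periodsT3 F K) c₀ W₂ →ₗ[ℂ] (Site (F.P K) (K - n) → Matrix (Fin 2) (Fin 2) ℂ))
      (D' : (Site (F.P K) (K - n) → Matrix (Fin 2) (Fin 2) ℂ) →ₗ[ℂ] WL2 ℂ (fun _ : PBond (F.P n) 0 => cB) W₂),
      (∀ l, QL2 F n K h c₀ cB U₀ (DL2 F n K c₀ U₀ l) = D' (Q'' l)) ∧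
      (RS F n K h c₀ cB U₀ = projR (covLapSite F n K c₀ U₀) Q'' ↔
        ∀ cf : Site (F.P K) (K - n) → Matrix (Fin 2) (Fin 2) ℂ,
          (∀ e : PBond (F.P K) (K - n), cf e.src = ((emlIterU (K - n) (bgUnits F K U₀) e : (Matrix (Fin 2) (Fin 2) ℂ)ˣ) : Matrix (Fin 2) (Fin 2) ℂ) * cf e.tgt *
            (((emlIterU (K - n) (bgUnits F K U₀) e)⁻¹ : (Matrix (Fin 2) (Fin 2) ℂ)ˣ) : Matrix (Fin 2) (Fin 2) ℂ)) →
          ∃ l₀ : Site (F.P K) 0 → Matrix (Fin 2) (Fin 2) ℂ,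
            (∀ b : PBond (F.P K) 0, l₀ b.src = ((bgUnits F K U₀ b : (Matrix (Fin 2) (Fin 2) ℂ)ˣ) : Matrix (Fin 2) (Fin 2) ℂ) * l₀ b.tgt * (((bgUnits F K U₀ b)⁻¹ : (Matrix (Fin 2) (Fin 2) ℂ)ˣ) : Matrix (Fin 2) (Fin 2) ℂ)) ∧
            ∀ y : Site (F.P K) (K - n), l₀ (embIter (K - n) y) = cf y) := by
  obtain ⟨Q'', D', hint, _, htop, _, hker⟩ := exists_intertwiner_of_regPr F h (c₀ := c₀) cB hε₀ hWε U₀ hreg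
  exact ⟨Q'', D', hint, RS_eq_projR_iff_lift F h cB hε₀ hWε U₀ hreg Q'' htop hker⟩

end Summit.QuantumFields.YangMills.Theorems.Prop7LiftOfRSEqPrintProjector

end
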